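import Mathlib
import Summits.AtomisticToContinuum.Crystallization.Theses.ThreeConeCertificate

/-!
# Sketch (crux-ideate 11959, ideator 3): the necessary-condition ladder of `ExactCertificate`

Every witness `(P, ρ, c, g, U, f)` of
`Summit.AtomisticToContinuum.Crystallization.Theses.ThreeConeCertificate.ExactCertificate` is tight on
large blocks of `P` (because `CertificateBound` gives `E_N ≥ N e(P)` while blocks of `P` achieve
`N e(P) + o(N)`), whence the four equalities below.  They reduce the crux to a ONE-SIDED RADIAL FOURIER
INTERPOLATION problem on the pair (shell radii of `P` beyond `ρ`, Bragg radii of `P`); see the memo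
`RIGIDITY-11959-ideator3.md` for why that pair is supercritical (no witness expected).  Statements only.
-/

namespace Summit.AtomisticToContinuum.Crystallization.Cruxes.ExactCertificate.Ideator3

open Literature.MathematicalPhysics.StatisticalMechanics

/-- The body of the crux, as a predicate on the six witnesses. -/
def IsWitness (P : PeriodicConfiguration 3) (ρ c : ℝ) (g U f : ℝ → ℝ) : Prop :=
  (∀ r : ℝ, 0 < r → lennardJones r = g r + U r + f r) ∧ (∀ r : ℝ, 0 < r → 0 ≤ U r) ∧
  (∀ r : ℝ, ρ ≤ r → g r = 0) ∧
  (∀ (n : ℕ) (y : Fin n → EuclideanSpace ℝ (Fin 3)) (w : Fin n → ℝ),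
      0 ≤ ∑ i, ∑ j, w i * w j * f (dist (y i) (y j))) ∧
  (∀ (N : ℕ) (x : Fin N → EuclideanSpace ℝ (Fin 3)), Function.Injective x →
      -(c * (N : ℝ)) ≤ interactionEnergy g x) ∧
  c + f 0 / 2 = -(P.energyPerParticle lennardJones)

/-- The crux is literally `∃ witnesses`. -/
theorem exactCertificate_iff :
    Theses.ThreeConeCertificate.ExactCertificate ↔
      ∃ (P : PeriodicConfiguration 3) (ρ c : ℝ) (g U f : ℝ → ℝ), IsWitness P ρ c g U f :=
  Iff.rfl

/-- N1 — the finite-range part is optimally stable AT `P`: `c = -e_g(P)`. -/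
def StableConstantAttainedAtP : Prop :=
  ∀ P ρ c g U f, IsWitness P ρ c g U f → c + P.energyPerParticle g = 0

/-- N2 — the slack cone dies on the whole distance set of `P`. -/
def SlackVanishesOnDistances : Prop :=
  ∀ P ρ c g U f, IsWitness P ρ c g U f →
    ∀ p ∈ P.points, ∀ q ∈ P.points, p ≠ q → U (dist p q) = 0

/-- N3 — hence the positive-type part TOUCHES `V_LJ` from below at every distance of `P` beyond `ρ`
(and `f ≤ V_LJ` on `[ρ, ∞)` since `U ≥ 0`, `g = 0` there). -/
def TailTouchesFarShells : Prop :=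
  ∀ P ρ c g U f, IsWitness P ρ c g U f →
    (∀ r : ℝ, ρ ≤ r → 0 < r → f r ≤ lennardJones r) ∧
    ∀ p ∈ P.points, ∀ q ∈ P.points, p ≠ q → ρ ≤ dist p q → f (dist p q) = lennardJones (dist p q)

/-- N4 — Bochner tightness on the crystal: the `f`-self-energy of `P` (diagonal included) vanishes,
`f(0) + 2 e_f(P) = 0`; by the diffraction form of Bochner's theorem this says `f̂(0) = 0` and `f̂ = 0` on
every non-extinct Bragg sphere of `P` ("`P` is invisible through `f`"). -/
def CrystalInvisibleThroughTail : Prop :=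
  ∀ P ρ c g U f, IsWitness P ρ c g U f → f 0 + 2 * P.energyPerParticle f = 0

/-- The disproof target isolated by N2–N4 (memo §3): NO RADIAL TAIL INTERPOLANT — for no periodic `P`
and no `ρ` is there a radially positive-type `f` with `f ≤ V_LJ` on `[ρ,∞)`, equality on the distances
of `P` beyond `ρ`, and vanishing `f`-self-energy of `P`.  (Believed TRUE by the density census of the
memo: the radii pair is ~16× supercritical for ideal hcp, ∞ for relaxed hcp.) -/
def NoRadialTailInterpolant : Prop :=
  ∀ (P : PeriodicConfiguration 3) (ρ : ℝ) (f : ℝ → ℝ),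
    (∀ (n : ℕ) (y : Fin n → EuclideanSpace ℝ (Fin 3)) (w : Fin n → ℝ),
        0 ≤ ∑ i, ∑ j, w i * w j * f (dist (y i) (y j))) →
    (∀ r : ℝ, ρ ≤ r → 0 < r → f r ≤ lennardJones r) →
    (∀ p ∈ P.points, ∀ q ∈ P.points, p ≠ q → ρ ≤ dist p q → f (dist p q) = lennardJones (dist p q)) →
    f 0 + 2 * P.energyPerParticle f = 0 → False

/-- Glue (pure logic): the three necessary conditions and the interpolation no-go refute the crux. -/
theorem not_exactCertificate_of (h3 : TailTouchesFarShells) (h4 : CrystalInvisibleThroughTail)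
    (hno : NoRadialTailInterpolant) : ¬ Theses.ThreeConeCertificate.ExactCertificate := by
  rintro ⟨P, ρ, c, g, U, f, hw⟩
  have hpd := hw.2.2.2.1
  obtain ⟨hle, heq⟩ := h3 P ρ c g U f hw
  exact hno P ρ f hpd hle heq (h4 P ρ c g U f hw)

/-- Conversely the magic-function crux of route ZeroPressureMagicFunction is the `ρ ≤ 0` case: a
radial zero-pressure magic function gives an exact certificate with `g = 0`, `c = 0` (so the
interpolation no-go bears on that route too).  Stated for a radial magic function. -/
theorem exactCertificate_of_radialMagic (P : PeriodicConfiguration 3) (f : ℝ → ℝ)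
    (hpd : ∀ (n : ℕ) (y : Fin n → EuclideanSpace ℝ (Fin 3)) (w : Fin n → ℝ),
        0 ≤ ∑ i, ∑ j, w i * w j * f (dist (y i) (y j)))
    (hle : ∀ r : ℝ, 0 < r → f r ≤ lennardJones r)
    (hval : f 0 / 2 = -(P.energyPerParticle lennardJones)) :
    Theses.ThreeConeCertificate.ExactCertificate := by
  refine ⟨P, 0, 0, fun _ => 0, fun r => lennardJones r - f r, f, ?_, ?_, ?_, hpd, ?_, ?_⟩
  · intro r _; ring
  · intro r hr; have := hle r hr; linarith
  · intro r _; rfl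
  · intro N x _
    simp [interactionEnergy]
  · simpa using hval

end Summit.AtomisticToContinuum.Crystallization.Cruxes.ExactCertificate.Ideator3
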